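import Mathlib
import Literature.NumberTheory.LFunctions.Zhang2022.Section6DedEq61
import Literature.NumberTheory.LFunctions.Zhang2022.Section6Lemma61Reflected
import Literature.NumberTheory.LFunctions.Zhang2022.Section6Eq62Holds
import HarnessLib

/-!
# Zhang (2022), §6: Lemma 6.1 in the reflected reading, kernel-closed

Topic `Literature/NumberTheory/LFunctions/Zhang2022` (Landau–Siegel audit tree; verdict-neutral).
Y. Zhang, *Discrete mean estimates and the Landau–Siegel zero*, arXiv:2211.02515v1 (2022)
[Zhang2022LandauSiegel] — an unrefereed manuscript under adjudication; nothing here asserts or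
denies its Theorems 1–2. Campaign D-0069, §6 join (L2 DISCHARGE LEDGER #10 (R28)).

Lemma 6.1 (§6 p. 31, tex L1706–1718, under the blanket Assumption (A) of tex L1559):

> "Suppose `ψ (mod p) ∈ Ψ`, `|σ − 1/2| < 2α` and `|t − 2πt₀| < 𝓛₁ + 2`. Then
> `L(s,ψ) = K(s,ψ) + Z(s,ψ)N(1−s,ψ̄) + O(E₁(s,ψ))`" [+ the negligible `ε = exp{−c𝓛¹⁰}`].

The printed proof's last step yields the error term `E₁` at the REFLECTED point `1 − s̄` rather than
at `s` (GAP-LEDGER G-d08-2, settled: repaired — identical on the critical line, harmless for the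
symmetric consumers). This file closes the whole §6 chain in that reading, with NO hypothesis left:

* `eq61_reflected` — (6.1) with error `E1main x (1 − s̄) + ε`, from the generic deduction
  `dedEq61_of_error` (`Section6DedEq61`, the printed "The proof of (6.1) is therefore reduced to showing
  (6.3)" with the error functional carried additively) applied to the theorems `step6u009_holds`
  (functional-equation split on `u = −1`, `Section6StepFE`), `eq62_holds` ((6.2), `Section6Eq62Holds`)
  and `eq63_reflected` ((6.3) in the reflected reading, `Section6Lemma61Reflected`);
* `lemma61_reflected` — **Lemma 6.1, (A)-form, error `E1main x (1 − s̄) + e^{−c𝓛¹⁰}`, unconditional in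
  its own inputs**: `lemma61_reflected_of_eq61R eq61_reflected` (which consumes `step6u007_holds`,
  the Perron/(4.3) step, and `Section6Shift.step6u008_holds`, the shift to `u = −1`);
* `lemma61_critical_line` — on `σ = ½` the reflected point is `s` itself, so there the statement holds
  with the printed error term `E1main x s`.

Theorems only; no new definitions or facts; axioms standard. The printed-reading nodes `Eq63`, `Eq61`,
`Lemma61A` stay typed (not derived here); see G-d08-2. WHAT THIS IS NOT: a claim that the printed
`E₁(s,ψ)` reading holds off the critical line, or anything about Theorems 1–2.

## References

* Y. Zhang, arXiv:2211.02515v1 (2022), §6 Lemma 6.1 and its proof, pp. 31–32, tex L1706–1777.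
  [cite: Zhang2022LandauSiegel, §6 Lemma 6.1 p.31]
-/

noncomputable section

open Complex Real

namespace Literature.NumberTheory.LFunctions.Zhang2022.Section6Statements

open Skeleton

/-- **`Z22:(6.1)`, reflected error term, PROVED outright**: for some absolute `c > 0`, `C` and all large
`D` (under (A)), every `ψ ∈ Ψ` and `s` in the range of Lemma 6.1,
`‖(1/2πi)∫_{(−1)} L(s+w,ψ)P₄^wω₁(w)dw/w + Z(s,ψ)N(1−s,ψ̄)‖ ≤ C·(E1main x (1 − s̄) + e^{−c𝓛¹⁰})` —
`dedEq61_of_error` at `E(x,s) = E1main x (1 − s̄)` applied to `step6u009_holds`, `eq62_holds`,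
`eq63_reflected`. [cite: Zhang2022LandauSiegel, §6 (6.1) p.31, tex L1715] -/
theorem eq61_reflected :
    ∃ c : ℝ, 0 < c ∧ ∃ C : ℝ, ForAllLarge fun D _ χ => AssumptionA D χ → ∀ x : Chr D, ∀ s : ℂ,
      InRange61 D s →
        ‖vline (integrandL x s) (-1) + GammaFactor.Zfac x.ψ s * Nchar D (psiBarFn x) (1 - s)‖
          ≤ C * (E1main x (1 - (starRingEnd ℂ) s) + Real.exp (-c * ell D ^ 10)) :=
  dedEq61_of_error (fun x s => E1main x (1 - (starRingEnd ℂ) s)) (fun x _ => E1main_nonneg x _)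
    step6u009_holds eq62_holds eq63_reflected

/-- **Lemma 6.1 in the reflected reading, kernel-closed** (§6 p. 31, (A)-form): for some absolute
`c > 0`, `C` and all large `D`, under (A), for every `ψ ∈ Ψ`, `|σ − ½| < 2α`, `|t − 2πt₀| < 𝓛₁ + 2`,
`‖L(s,ψ) − K(s,ψ) − Z(s,ψ)N(1−s,ψ̄)‖ ≤ C·(E1main x (1 − s̄) + e^{−c𝓛¹⁰})` — NO hypothesis: the whole
printed proof of Lemma 6.1 (Perron step, shift to `u = −1`, functional equation, (6.2), (6.4)–(6.5),
(6.3)) is now a chain of tree theorems; only the location of `E₁` differs from print (G-d08-2).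
[cite: Zhang2022LandauSiegel, §6 Lemma 6.1 p.31, tex L1706–1718] -/
theorem lemma61_reflected :
    ∃ c : ℝ, 0 < c ∧ ∃ C : ℝ, ForAllLarge fun D _ χ => AssumptionA D χ → ∀ x : Chr D, ∀ s : ℂ,
      |s.re - 1 / 2| < 2 * alpha D → |s.im - 2 * π * t0 D| < ell1 D + 2 →
        ‖x.ψ.LFunction s - Kchar D (psiFn x) s -
            GammaFactor.Zfac x.ψ s * Nchar D (psiBarFn x) (1 - s)‖
          ≤ C * (E1main x (1 - (starRingEnd ℂ) s) + Real.exp (-c * ell D ^ 10)) :=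
  lemma61_reflected_of_eq61R eq61_reflected

/-- **Lemma 6.1 on the critical line, printed error term**: on `σ = ½` the reflected point `1 − s̄` is
`s`, so for `s = ½ + it`, `|t − 2πt₀| < 𝓛₁ + 2`, `ψ ∈ Ψ`, under (A) and for all large `D`,
`‖L(s,ψ) − K(s,ψ) − Z(s,ψ)N(1−s,ψ̄)‖ ≤ C·(E₁(s,ψ) + e^{−c𝓛¹⁰})` exactly as printed.
[cite: Zhang2022LandauSiegel, §6 Lemma 6.1 p.31, tex L1706–1718] -/
theorem lemma61_critical_line :
    ∃ c : ℝ, 0 < c ∧ ∃ C : ℝ, ForAllLarge fun D _ χ => AssumptionA D χ → ∀ x : Chr D, ∀ s : ℂ,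
      s.re = 1 / 2 → |s.im - 2 * π * t0 D| < ell1 D + 2 →
        ‖x.ψ.LFunction s - Kchar D (psiFn x) s -
            GammaFactor.Zfac x.ψ s * Nchar D (psiBarFn x) (1 - s)‖
          ≤ C * (E1main x s + Real.exp (-c * ell D ^ 10)) := by
  obtain ⟨c, hc, C, D₀, h⟩ := lemma61_reflected
  refine ⟨c, hc, C, max D₀ 2, fun D _ χ hD hq hp hA x s hσ ht => ?_⟩
  have hD₀ : D₀ ≤ D := le_of_max_le_left hD
  have hD2 : 2 ≤ D := le_of_max_le_right hD
  have hα : 0 < alpha D := by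
    rw [alpha, bigP, Real.log_exp]
    have h2 : (2 : ℝ) ≤ D := by exact_mod_cast hD2
    exact div_pos Real.pi_pos (pow_pos (Real.log_pos (by linarith)) 9)
  have hrefl : 1 - (starRingEnd ℂ) s = s := by
    apply Complex.ext
    · simp [hσ]; norm_num
    · simp
  have h1 := h D χ hD₀ hq hp hA x s (by rw [hσ, sub_self, abs_zero]; positivity) ht
  rw [hrefl] at h1
  exact h1

end Literature.NumberTheory.LFunctions.Zhang2022.Section6Statements
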